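import Literature.NumberTheory.Automorphic.CuspidalCohomologyGL
import Literature.Algebra.Homology.GroupCohomologySemilinear
import HarnessLib

/-!
# Semilinear symmetries of the cohomology of arithmetic quotients, commuting with Hecke operators

Topic `Literature/NumberTheory/Automorphic`; namespace `Literature.NumberTheory.Automorphic`, in
the grouping sub-namespaces `ArithmeticQuotient` (constant coefficients `Fun(𝒢 ⧸ L, M)`,
`ArithmeticQuotientCohomology.lean`) and `TwistedQuotient` (twisted coefficients `Fun(𝒢 ⧸ L, V)`
of a representation `ρ` of `Γ`, `CuspidalCohomologyGL.lean`). Everything is proved; no named fact.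

For an arithmetic quotient `S_L = Γ \ (X × 𝒢 ⧸ L)` the tree computes `H^q(S_L, Ṽ)` as the group
cohomology `H^q(Γ, Fun(𝒢 ⧸ L, V))` (Mathlib `groupCohomology`) and the Hecke operator `[L g L]`
as `groupCohomology.map (MonoidHom.id Γ)` of the `Γ`-equivariant operator
`(T_g f)(xL) = ∑_{hL ⊆ LgL} f(xhL)` on the coefficients. A `σ`-SEMILINEAR map of coefficient
modules `s₀ : V → V'` (`σ : k → k'` a ring homomorphism) intertwining the representations
`ρ`, `ρ'` of `Γ` acts on `Fun(𝒢 ⧸ L, V)` by post-composition, commuting with the `Γ`-action and —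
being additive — with every `T_g` (a finite sum of translates); by the semilinear functoriality of
group cohomology (`Literature.Algebra.Homology.semimap`, file
`Literature/Algebra/Homology/GroupCohomologySemilinear.lean`) it therefore induces a `σ`-semilinear
map `H^q(S_L, Ṽ) → H^q(S_L, Ṽ')` COMMUTING WITH ALL HECKE OPERATORS, functorial in `s₀` (so that
a group of semilinear automorphisms of the coefficients, e.g. `Aut(ℂ/E)` acting on `V_E ⊗_E ℂ`
through the second factor, acts on the cohomology by Hecke-equivariant semilinear bijections).

This is the formal mechanism behind the `Aut(ℂ)`-action on the Betti cohomology of arithmetic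
locally symmetric spaces with algebraic coefficients used in Clozel's proof that the Hecke field of
a regular algebraic cuspidal representation of `GL_n` is a number field (Clozel 1990, Thm. 3.13,
proof in §3.5; the abstract form of that step is the tree's
`heckeEigenvalue_mem_subfield_of_semilinearSymmetry`,
`ClozelAlgebraicityHeckeFieldSymmetryProofs.lean`, whose hypothesis `hsymm` asks exactly for
Hecke-commuting maps `g_σ`, `σ`-semilinear on an eigenline, not killing the eigenvector: here
`g_σ = Hⁿ(s_σ)` is `σ`-semilinear everywhere, commutes with every `T_g`, and is injective as soon
as `s_σ` has a semilinear equivariant left inverse, `cohomologySemimap_injective_of_leftInverse`).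

## Main results

* `ArithmeticQuotient.coeffSemimap`, `TwistedQuotient.coeffSemimap` — post-composition
  `Fun(𝒢 ⧸ L, V) →ₛₗ[σ] Fun(𝒢 ⧸ L, V')`; equivariance (`coeffSemimap_coeffRepresentation`) and
  `heckeFun_coeffSemimap` (`T_g (s₀ ∘ f) = s₀ ∘ T_g f`).
* `ArithmeticQuotient.cohomologySemimap`, `TwistedQuotient.cohomologySemimap` —
  the `σ`-semilinear maps `H^q(S_L, Ṽ) → H^q(S_L, Ṽ')`, with `…_heckeOperator` /
  `…_heckeEnd` (commute with `[L g L]`), `…_eq_self` (identity), `…_cohomologySemimap`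
  (composition), `…_injective_of_leftInverse`, `…_surjective_of_rightInverse`.

## References

* L. Clozel, *Motifs et formes automorphes: applications du principe de fonctorialité*, in:
  Automorphic forms, Shimura varieties, and L-functions I (Ann Arbor 1988), Academic Press 1990,
  Thm. 3.13 and its proof, §3.5. [Clozel1990]
* K. S. Brown, *Cohomology of Groups*, GTM 87 (1982), III.1 Example 3 (standard cochains) and
  III.8 (functoriality). [Brown1982CohomologyGroups]
* G. Shimura, *Introduction to the arithmetic theory of automorphic functions* (1971), Ch. 3, §8.3
  (double coset operators). [ShimuraIATAF1971]
-/

noncomputable section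

open CategoryTheory
open Literature.Algebra.Homology

universe u

namespace Literature.NumberTheory.Automorphic

/-! ### Constant coefficients `Fun(𝒢 ⧸ L, M)` (`ArithmeticQuotient`) -/

namespace ArithmeticQuotient

variable {k k' : Type u} [CommRing k] [CommRing k'] {Γ 𝒢 : Type u} [Group Γ] [Group 𝒢]
  (ι : Γ →* 𝒢) (L : Subgroup 𝒢) {M : Type u} [AddCommGroup M] [Module k M]
  {M' : Type u} [AddCommGroup M'] [Module k' M'] {σ : k →+* k'}

/-- Post-composition of `M`-valued functions on `𝒢 ⧸ L` with a `σ`-semilinear map of coefficients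
`s₀ : M → M'`. [folklore] -/
def coeffSemimap (s₀ : M →ₛₗ[σ] M') : ((𝒢 ⧸ L) → M) →ₛₗ[σ] ((𝒢 ⧸ L) → M') where
  toFun f := fun c => s₀ (f c)
  map_add' f f' := by
    funext c
    simp
  map_smul' a f := by
    funext c
    simp [map_smulₛₗ]

/-- Unfolding lemma: `(s₀ ∘ f)(c) = s₀ (f c)`. [folklore] -/
@[simp]
theorem coeffSemimap_apply (s₀ : M →ₛₗ[σ] M') (f : (𝒢 ⧸ L) → M) (c : 𝒢 ⧸ L) :
    coeffSemimap L s₀ f c = s₀ (f c) :=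
  rfl

/-- Post-composition commutes with the left-translation action of `Γ` on `Fun(𝒢 ⧸ L, -)`.
[folklore] -/
theorem coeffSemimap_coeffRepresentation (s₀ : M →ₛₗ[σ] M') (γ : Γ) (f : (𝒢 ⧸ L) → M) :
    coeffSemimap L s₀ (coeffRepresentation k ι L M γ f) =
      coeffRepresentation k' ι L M' γ (coeffSemimap L s₀ f) := by
  funext c
  simp

/-- **Hecke operators commute with additive maps of coefficients**:
`T_g (s₀ ∘ f) = s₀ ∘ T_g f` for the double coset operator `(T_g f)(xL) = ∑_{hL ⊆ LgL} f(xhL)`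
(a finite sum of translates; both sides are `0` in the junk case of an infinite double coset).
[cite: ShimuraIATAF1971, Ch. 3, §8.3] -/
theorem heckeFun_coeffSemimap (s₀ : M →ₛₗ[σ] M') (g : 𝒢) (f : (𝒢 ⧸ L) → M) :
    heckeFun k' L g M' (coeffSemimap L s₀ f) = coeffSemimap L s₀ (heckeFun k L g M f) := by
  funext c
  rw [heckeFun_apply, coeffSemimap_apply, heckeFun_apply]
  split_ifs with h
  · rw [map_sum]
    rfl
  · exact (map_zero s₀).symm

/-- **The `σ`-semilinear map `H^i(X_L, M) → H^i(X_L, M')` induced by a `σ`-semilinear map of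
coefficients** `s₀ : M → M'` (semilinear functoriality of `H^i(Γ, Fun(𝒢 ⧸ L, -))`,
`Literature.Algebra.Homology.semimap`). [cite: Clozel1990, Thm. 3.13 (proof, §3.5)] -/
def cohomologySemimap (s₀ : M →ₛₗ[σ] M') (i : ℕ) :
    cohomology k ι L M i →ₛₗ[σ] cohomology k' ι L M' i :=
  semimap (A := coeffRep k ι L M) (B := coeffRep k' ι L M') (coeffSemimap L s₀)
    (coeffSemimap_coeffRepresentation ι L s₀) i

/-- **`Hⁱ(s₀)` commutes with the Hecke operators `[L g L]`** on `H^i(X_L, -)`.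
[cite: Clozel1990, Thm. 3.13 (proof, §3.5)] -/
theorem cohomologySemimap_heckeOperator (s₀ : M →ₛₗ[σ] M') (g : 𝒢) (i : ℕ)
    (x : cohomology k ι L M i) :
    cohomologySemimap ι L s₀ i (heckeOperator k L g M ι i x) =
      heckeOperator k' L g M' ι i (cohomologySemimap ι L s₀ i x) :=
  semimap_map (A := coeffRep k ι L M) (B := coeffRep k' ι L M') (A₂ := coeffRep k ι L M)
    (B₂ := coeffRep k' ι L M') (coeffSemimap L s₀) (coeffSemimap_coeffRepresentation ι L s₀)
    (coeffSemimap L s₀) (coeffSemimap_coeffRepresentation ι L s₀) (heckeRepHom k L g M ι)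
    (heckeRepHom k' L g M' ι) (fun f => (heckeFun_coeffSemimap L s₀ g f).symm) i x

/-- `Hⁱ(s₀)` commutes with the Hecke operators, `Module.End` form (`heckeEnd`). [folklore] -/
theorem cohomologySemimap_heckeEnd (s₀ : M →ₛₗ[σ] M') (g : 𝒢) (i : ℕ)
    (x : cohomology k ι L M i) :
    cohomologySemimap ι L s₀ i (heckeEnd k L g M ι i x) =
      heckeEnd k' L g M' ι i (cohomologySemimap ι L s₀ i x) :=
  cohomologySemimap_heckeOperator ι L s₀ g i x

/-- Identity: if `s₀` is the identity map of `M` then `Hⁱ(s₀) = id`. [folklore] -/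
theorem cohomologySemimap_eq_self {τ : k →+* k} (s₀ : M →ₛₗ[τ] M) (h : ∀ m, s₀ m = m) (i : ℕ)
    (x : cohomology k ι L M i) : cohomologySemimap ι L s₀ i x = x :=
  semimap_eq_self (A := coeffRep k ι L M) (coeffSemimap L s₀)
    (coeffSemimap_coeffRepresentation ι L s₀) (fun f => funext fun c => h (f c)) i x

/-- Composition: `Hⁱ(s₀') ∘ Hⁱ(s₀) = Hⁱ(t₀)` whenever `t₀ = s₀' ∘ s₀`. [folklore] -/
theorem cohomologySemimap_cohomologySemimap {k'' : Type u} [CommRing k''] {M'' : Type u}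
    [AddCommGroup M''] [Module k'' M''] {σ' : k' →+* k''} {τ : k →+* k''} (s₀ : M →ₛₗ[σ] M')
    (s₀' : M' →ₛₗ[σ'] M'') (t₀ : M →ₛₗ[τ] M'') (h : ∀ m, t₀ m = s₀' (s₀ m)) (i : ℕ)
    (x : cohomology k ι L M i) :
    cohomologySemimap ι L s₀' i (cohomologySemimap ι L s₀ i x) = cohomologySemimap ι L t₀ i x :=
  semimap_semimap (A := coeffRep k ι L M) (B := coeffRep k' ι L M') (C := coeffRep k'' ι L M'')
    (coeffSemimap L s₀) (coeffSemimap_coeffRepresentation ι L s₀) (coeffSemimap L s₀')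
    (coeffSemimap_coeffRepresentation ι L s₀') (coeffSemimap L t₀)
    (coeffSemimap_coeffRepresentation ι L t₀) (fun f => funext fun c => h (f c)) i x

/-- A coefficient map with a semilinear left inverse induces an injective map `Hⁱ(s₀)` (so a
semilinear AUTOMORPHISM group of `M`, e.g. `Aut(ℂ/E)` on `M_E ⊗_E ℂ`, acts by injective — indeed
bijective — Hecke-equivariant semilinear maps on `H^i(X_L, M)`). [folklore] -/
theorem cohomologySemimap_injective_of_leftInverse {σ' : k' →+* k} (s₀ : M →ₛₗ[σ] M')
    (s₀' : M' →ₛₗ[σ'] M) (h : ∀ m, s₀' (s₀ m) = m) (i : ℕ) :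
    Function.Injective (cohomologySemimap ι L s₀ i) :=
  semimap_injective_of_leftInverse (A := coeffRep k ι L M) (B := coeffRep k' ι L M')
    (coeffSemimap L s₀) (coeffSemimap_coeffRepresentation ι L s₀) (coeffSemimap L s₀')
    (coeffSemimap_coeffRepresentation ι L s₀') (fun f => funext fun c => h (f c)) i

/-- A coefficient map with a semilinear right inverse induces a surjective map `Hⁱ(s₀)`. [folklore] -/
theorem cohomologySemimap_surjective_of_rightInverse {σ' : k' →+* k} (s₀ : M →ₛₗ[σ] M')
    (s₀' : M' →ₛₗ[σ'] M) (h : ∀ m', s₀ (s₀' m') = m') (i : ℕ) :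
    Function.Surjective (cohomologySemimap ι L s₀ i) :=
  semimap_surjective_of_rightInverse (A := coeffRep k ι L M) (B := coeffRep k' ι L M')
    (coeffSemimap L s₀) (coeffSemimap_coeffRepresentation ι L s₀) (coeffSemimap L s₀')
    (coeffSemimap_coeffRepresentation ι L s₀') (fun f => funext fun c => h (f c)) i

end ArithmeticQuotient

/-! ### Twisted coefficients `Fun(𝒢 ⧸ L, V)` (`TwistedQuotient`) -/

namespace TwistedQuotient

variable {k k' : Type u} [CommRing k] [CommRing k'] {Γ 𝒢 : Type u} [Group Γ] [Group 𝒢]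
  (ι : Γ →* 𝒢) (L : Subgroup 𝒢) {V : Type u} [AddCommGroup V] [Module k V]
  {V' : Type u} [AddCommGroup V'] [Module k' V'] (ρ : Representation k Γ V)
  (ρ' : Representation k' Γ V') {σ : k →+* k'}

/-- Post-composition of `V`-valued functions on `𝒢 ⧸ L` with a `σ`-semilinear map of coefficients
`s₀ : V → V'`. [folklore] -/
def coeffSemimap (s₀ : V →ₛₗ[σ] V') : ((𝒢 ⧸ L) → V) →ₛₗ[σ] ((𝒢 ⧸ L) → V') where
  toFun f := fun c => s₀ (f c)
  map_add' f f' := by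
    funext c
    simp
  map_smul' a f := by
    funext c
    simp [map_smulₛₗ]

/-- Unfolding lemma: `(s₀ ∘ f)(c) = s₀ (f c)`. [folklore] -/
@[simp]
theorem coeffSemimap_apply (s₀ : V →ₛₗ[σ] V') (f : (𝒢 ⧸ L) → V) (c : 𝒢 ⧸ L) :
    coeffSemimap L s₀ f c = s₀ (f c) :=
  rfl

/-- Post-composition with an `s₀` intertwining `ρ` and `ρ'` commutes with the twisted actions
`(γ • f)(c) = ρ(γ) f(ι(γ)⁻¹ c)` of `Γ`. [folklore] -/
theorem coeffSemimap_coeffRepresentation (s₀ : V →ₛₗ[σ] V')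
    (hs₀ : ∀ (γ : Γ) (v : V), s₀ (ρ γ v) = ρ' γ (s₀ v)) (γ : Γ) (f : (𝒢 ⧸ L) → V) :
    coeffSemimap L s₀ (coeffRepresentation ι L ρ γ f) =
      coeffRepresentation ι L ρ' γ (coeffSemimap L s₀ f) := by
  funext c
  simp [hs₀]

/-- **Hecke operators commute with additive maps of coefficients** (twisted coefficients):
`T_g (s₀ ∘ f) = s₀ ∘ T_g f`. [cite: ShimuraIATAF1971, Ch. 3, §8.3] -/
theorem heckeFun_coeffSemimap (s₀ : V →ₛₗ[σ] V') (g : 𝒢) (f : (𝒢 ⧸ L) → V) :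
    ArithmeticQuotient.heckeFun k' L g V' (coeffSemimap L s₀ f) =
      coeffSemimap L s₀ (ArithmeticQuotient.heckeFun k L g V f) := by
  funext c
  rw [ArithmeticQuotient.heckeFun_apply, coeffSemimap_apply, ArithmeticQuotient.heckeFun_apply]
  split_ifs with h
  · rw [map_sum]
    rfl
  · exact (map_zero s₀).symm

/-- **The `σ`-semilinear map `H^q(S_L, Ṽ) → H^q(S_L, Ṽ')` induced by a `σ`-semilinear map of
coefficients `s₀ : V → V'` intertwining `ρ` and `ρ'`** (semilinear functoriality of
`H^q(Γ, Fun(𝒢 ⧸ L, -))`). In Clozel's setting: `V = V_λ(E) ⊗_E ℂ`, `s₀ = 1 ⊗ σ`, `σ ∈ Aut(ℂ/E)`.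
[cite: Clozel1990, Thm. 3.13 (proof, §3.5)] -/
def cohomologySemimap (s₀ : V →ₛₗ[σ] V') (hs₀ : ∀ (γ : Γ) (v : V), s₀ (ρ γ v) = ρ' γ (s₀ v))
    (q : ℕ) : cohomology ι L ρ q →ₛₗ[σ] cohomology ι L ρ' q :=
  semimap (A := coeffRep ι L ρ) (B := coeffRep ι L ρ') (coeffSemimap L s₀)
    (coeffSemimap_coeffRepresentation ι L ρ ρ' s₀ hs₀) q

/-- **`H^q(s₀)` commutes with the Hecke operators `[L g L]`** on `H^q(S_L, -)`.
[cite: Clozel1990, Thm. 3.13 (proof, §3.5)] -/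
theorem cohomologySemimap_heckeOperator (s₀ : V →ₛₗ[σ] V')
    (hs₀ : ∀ (γ : Γ) (v : V), s₀ (ρ γ v) = ρ' γ (s₀ v)) (g : 𝒢) (q : ℕ) (x : cohomology ι L ρ q) :
    cohomologySemimap ι L ρ ρ' s₀ hs₀ q (heckeOperator ι L ρ g q x) =
      heckeOperator ι L ρ' g q (cohomologySemimap ι L ρ ρ' s₀ hs₀ q x) :=
  semimap_map (A := coeffRep ι L ρ) (B := coeffRep ι L ρ') (A₂ := coeffRep ι L ρ)
    (B₂ := coeffRep ι L ρ') (coeffSemimap L s₀) (coeffSemimap_coeffRepresentation ι L ρ ρ' s₀ hs₀)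
    (coeffSemimap L s₀) (coeffSemimap_coeffRepresentation ι L ρ ρ' s₀ hs₀) (heckeRepHom ι L ρ g)
    (heckeRepHom ι L ρ' g) (fun f => (heckeFun_coeffSemimap L s₀ g f).symm) q x

/-- `H^q(s₀)` commutes with the Hecke operators, `Module.End` form (`heckeEnd`). [folklore] -/
theorem cohomologySemimap_heckeEnd (s₀ : V →ₛₗ[σ] V')
    (hs₀ : ∀ (γ : Γ) (v : V), s₀ (ρ γ v) = ρ' γ (s₀ v)) (g : 𝒢) (q : ℕ) (x : cohomology ι L ρ q) :
    cohomologySemimap ι L ρ ρ' s₀ hs₀ q (heckeEnd ι L ρ g q x) =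
      heckeEnd ι L ρ' g q (cohomologySemimap ι L ρ ρ' s₀ hs₀ q x) :=
  cohomologySemimap_heckeOperator ι L ρ ρ' s₀ hs₀ g q x

/-- Identity: if `s₀` is the identity map of `V` then `H^q(s₀) = id`. [folklore] -/
theorem cohomologySemimap_eq_self {τ : k →+* k} (s₀ : V →ₛₗ[τ] V)
    (hs₀ : ∀ (γ : Γ) (v : V), s₀ (ρ γ v) = ρ γ (s₀ v)) (h : ∀ v, s₀ v = v) (q : ℕ)
    (x : cohomology ι L ρ q) : cohomologySemimap ι L ρ ρ s₀ hs₀ q x = x :=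
  semimap_eq_self (A := coeffRep ι L ρ) (coeffSemimap L s₀)
    (coeffSemimap_coeffRepresentation ι L ρ ρ s₀ hs₀) (fun f => funext fun c => h (f c)) q x

/-- Composition: `H^q(s₀') ∘ H^q(s₀) = H^q(t₀)` whenever `t₀ = s₀' ∘ s₀`. [folklore] -/
theorem cohomologySemimap_cohomologySemimap {k'' : Type u} [CommRing k''] {V'' : Type u}
    [AddCommGroup V''] [Module k'' V''] (ρ'' : Representation k'' Γ V'') {σ' : k' →+* k''}
    {τ : k →+* k''} (s₀ : V →ₛₗ[σ] V') (hs₀ : ∀ (γ : Γ) (v : V), s₀ (ρ γ v) = ρ' γ (s₀ v))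
    (s₀' : V' →ₛₗ[σ'] V'') (hs₀' : ∀ (γ : Γ) (v : V'), s₀' (ρ' γ v) = ρ'' γ (s₀' v))
    (t₀ : V →ₛₗ[τ] V'') (ht₀ : ∀ (γ : Γ) (v : V), t₀ (ρ γ v) = ρ'' γ (t₀ v))
    (h : ∀ v, t₀ v = s₀' (s₀ v)) (q : ℕ) (x : cohomology ι L ρ q) :
    cohomologySemimap ι L ρ' ρ'' s₀' hs₀' q (cohomologySemimap ι L ρ ρ' s₀ hs₀ q x) =
      cohomologySemimap ι L ρ ρ'' t₀ ht₀ q x :=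
  semimap_semimap (A := coeffRep ι L ρ) (B := coeffRep ι L ρ') (C := coeffRep ι L ρ'')
    (coeffSemimap L s₀) (coeffSemimap_coeffRepresentation ι L ρ ρ' s₀ hs₀) (coeffSemimap L s₀')
    (coeffSemimap_coeffRepresentation ι L ρ' ρ'' s₀' hs₀') (coeffSemimap L t₀)
    (coeffSemimap_coeffRepresentation ι L ρ ρ'' t₀ ht₀) (fun f => funext fun c => h (f c)) q x

/-- A coefficient map with a semilinear equivariant left inverse induces an injective `H^q(s₀)`.
[folklore] -/
theorem cohomologySemimap_injective_of_leftInverse {σ' : k' →+* k} (s₀ : V →ₛₗ[σ] V')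
    (hs₀ : ∀ (γ : Γ) (v : V), s₀ (ρ γ v) = ρ' γ (s₀ v)) (s₀' : V' →ₛₗ[σ'] V)
    (hs₀' : ∀ (γ : Γ) (v : V'), s₀' (ρ' γ v) = ρ γ (s₀' v)) (h : ∀ v, s₀' (s₀ v) = v) (q : ℕ) :
    Function.Injective (cohomologySemimap ι L ρ ρ' s₀ hs₀ q) :=
  semimap_injective_of_leftInverse (A := coeffRep ι L ρ) (B := coeffRep ι L ρ')
    (coeffSemimap L s₀) (coeffSemimap_coeffRepresentation ι L ρ ρ' s₀ hs₀) (coeffSemimap L s₀')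
    (coeffSemimap_coeffRepresentation ι L ρ' ρ s₀' hs₀') (fun f => funext fun c => h (f c)) q

/-- A coefficient map with a semilinear equivariant right inverse induces a surjective `H^q(s₀)`.
[folklore] -/
theorem cohomologySemimap_surjective_of_rightInverse {σ' : k' →+* k} (s₀ : V →ₛₗ[σ] V')
    (hs₀ : ∀ (γ : Γ) (v : V), s₀ (ρ γ v) = ρ' γ (s₀ v)) (s₀' : V' →ₛₗ[σ'] V)
    (hs₀' : ∀ (γ : Γ) (v : V'), s₀' (ρ' γ v) = ρ γ (s₀' v)) (h : ∀ v', s₀ (s₀' v') = v') (q : ℕ) :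
    Function.Surjective (cohomologySemimap ι L ρ ρ' s₀ hs₀ q) :=
  semimap_surjective_of_rightInverse (A := coeffRep ι L ρ) (B := coeffRep ι L ρ')
    (coeffSemimap L s₀) (coeffSemimap_coeffRepresentation ι L ρ ρ' s₀ hs₀) (coeffSemimap L s₀')
    (coeffSemimap_coeffRepresentation ι L ρ' ρ s₀' hs₀') (fun f => funext fun c => h (f c)) q

/-- `H^q(s₀)` preserves the eigen-relation: if `T_g x = t • x` then `T_g (H^q(s₀) x) = σ t • H^q(s₀) x`
— the `σ`-conjugate eigensystem occurs on `H^q(s₀) x`. [cite: Clozel1990, Thm. 3.13 (proof, §3.5)] -/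
theorem heckeEnd_cohomologySemimap_of_eigen (s₀ : V →ₛₗ[σ] V')
    (hs₀ : ∀ (γ : Γ) (v : V), s₀ (ρ γ v) = ρ' γ (s₀ v)) (g : 𝒢) (q : ℕ) {x : cohomology ι L ρ q}
    {t : k} (hx : heckeEnd ι L ρ g q x = t • x) :
    heckeEnd ι L ρ' g q (cohomologySemimap ι L ρ ρ' s₀ hs₀ q x) =
      σ t • cohomologySemimap ι L ρ ρ' s₀ hs₀ q x := by
  rw [← cohomologySemimap_heckeEnd, hx, map_smulₛₗ]

end TwistedQuotient

end Literature.NumberTheory.Automorphic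

end
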